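import Literature.Probability.LatticeModels.KCConfigRays
import HarnessLib

/-!
# The hub of the sign-condition configuration

Topic `Literature/Probability/LatticeModels`. The local, fully explicit part of the construction of
a `KCSignConfig`: the **hub data** (`HubData Ω`) — a point `m` of the open set `Ω` on the sphere
of radius `ρ_B = (51/50) r*` about an exterior centre `e` with `ball e r* ∩ Ω = ∅`, the lattice
direction `ν = dirVec km` closest to `e - m`, and a scale `r_h` with `closedBall m (10 r_h) ⊆ Ω` —
and, built from it: the fan of three rays `ν`, `d± = (15 ν ± 8 τ)/17` (a Pythagorean triple, so
the directions are unit vectors with rational frame coordinates), their first exits `L`, the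
flat piece `F = pmid ± 8ℓ τ` (`pmid = m + r_h ν`, `ℓ = r_h/100`), the splice points
`A± = m + 2 r_h d±`, and the middle paths `M₁`, `M₂`.

The two families of facts proved here are the ones the `KCSignConfig` conditions reduce to:
**frame facts** (normal/tangential coordinates `N`, `T` relative to `pmid` of all the pieces: the
middle set has `N ≥ 0` and, off `F`, `|T| ≥ 8ℓ`) and **ball facts** (all the pieces lie in the
open ball `ball e ρ_B`, by the chord computation `‖m + v - e‖² = ρ_B² - 2⟪e - m, v⟫ + ‖v‖²`).

All `[folklore]`; no named fact.
-/

noncomputable section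

open Set Metric

namespace Literature.Probability.LatticeModels

open Site

/-! ### Frame and chord algebra -/

/-- `rdot` is additive in the second slot. [folklore] -/
theorem rdot_add_right (E v w : ℂ) : rdot E (v + w) = rdot E v + rdot E w := by
  simp only [rdot_eq, Complex.add_re, Complex.add_im]; ring

/-- `rdot` is real-homogeneous in the second slot. [folklore] -/
theorem rdot_real_mul_right (E : ℂ) (t : ℝ) (v : ℂ) : rdot E ((t : ℂ) * v) = t * rdot E v := by
  simp only [rdot_eq, Complex.mul_re, Complex.mul_im, Complex.ofReal_re, Complex.ofReal_im, zero_mul, sub_zero, add_zero]; ring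

/-- Frame coordinates of a frame combination `x e_k + y e_{k+1}`. [folklore] -/
theorem dirCoord_frame_comb (k : Fin 4) (x y : ℝ) :
    dirCoord k ((x : ℂ) * dirVec k + (y : ℂ) * dirVec (k + 1)) = x ∧ dirCoord (k + 1) ((x : ℂ) * dirVec k + (y : ℂ) * dirVec (k + 1)) = y := by
  simp only [dirCoord_add, dirCoord_mul_dirVec_self, dirCoord_mul_dirVec_succ, dirCoord_succ_mul_dirVec,
    add_zero, zero_add, and_self]

/-- **The chord criterion**: for `‖m - e‖ = ρ`, `m + v ∈ ball e ρ ↔ ‖v‖² < 2 ⟪e - m, v⟫`. [folklore] -/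
theorem add_mem_ball_iff {m e : ℂ} {ρ : ℝ} (hme : ‖m - e‖ = ρ) (v : ℂ) : m + v ∈ ball e ρ ↔ ‖v‖ ^ 2 < 2 * rdot (e - m) v := by
  have key : ‖m + v - e‖ ^ 2 = ρ ^ 2 - 2 * rdot (e - m) v + ‖v‖ ^ 2 := by
    rw [← hme, Complex.sq_norm, Complex.sq_norm, Complex.sq_norm, Complex.normSq_apply, Complex.normSq_apply, Complex.normSq_apply, rdot_eq]
    simp only [Complex.sub_re, Complex.sub_im, Complex.add_re, Complex.add_im]; ring
  have hρ : 0 ≤ ρ := hme ▸ norm_nonneg _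
  rw [mem_ball, dist_eq_norm]
  constructor
  · intro h
    have h2 : ‖m + v - e‖ ^ 2 < ρ ^ 2 := by nlinarith [norm_nonneg (m + v - e)]
    linarith
  · intro h
    have h2 : ‖m + v - e‖ ^ 2 < ρ ^ 2 := by linarith
    nlinarith [norm_nonneg (m + v - e)]

/-! ### The hub data -/

/-- **Hub data** of a sign-condition configuration in the open set `Ω`. [folklore] -/
structure HubData (Ω : Set ℂ) where
  /-- the hub point -/
  m : ℂ
  /-- the exterior centre and the radius of the exterior ball -/
  e : ℂ
  rstar : ℝ
  /-- the lattice direction closest to `e - m` -/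
  km : Fin 4
  /-- the hub scale -/
  rh : ℝ
  isOpen : IsOpen Ω
  rstar_pos : 0 < rstar
  ball_disjoint : ∀ x ∈ ball e rstar, x ∉ Ω
  norm_sub : ‖m - e‖ = 51 / 50 * rstar
  dir_le : |dirCoord (km + 1) (e - m)| ≤ dirCoord km (e - m)
  rh_pos : 0 < rh
  closedBall_subset : closedBall m (10 * rh) ⊆ Ω

namespace HubData

variable {Ω : Set ℂ} (hub : HubData Ω)

/-- The radius of the big ball. [folklore] -/
def ρB : ℝ := 51 / 50 * hub.rstar

/-- The normal direction `ν`. [folklore] -/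
def ν : ℂ := dirVec hub.km

/-- The tangential direction `τ`. [folklore] -/
def τ : ℂ := dirVec (hub.km + 1)

/-- The normal coordinate of `e - m`. [folklore] -/
def a : ℝ := dirCoord hub.km (hub.e - hub.m)

/-- The tangential coordinate of `e - m`. [folklore] -/
def b : ℝ := dirCoord (hub.km + 1) (hub.e - hub.m)

/-- The end directions `d± = (15 ν ± 8 τ)/17` (`sgn = ±1`). [folklore] -/
def dEnd (sgn : ℝ) : ℂ := ((15 / 17 : ℝ) : ℂ) * hub.ν + ((sgn * (8 / 17) : ℝ) : ℂ) * hub.τ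

/-- The flat-piece scale `ℓ = r_h / 100`. [folklore] -/
def ell : ℝ := hub.rh / 100

/-- The midpoint of the flat piece. [folklore] -/
def pmid : ℂ := hub.m + ((hub.rh : ℝ) : ℂ) * hub.ν

/-- The normal frame coordinate relative to `pmid`. [folklore] -/
def N (x : ℂ) : ℝ := dirCoord hub.km (x - hub.pmid)

/-- The tangential frame coordinate relative to `pmid`. [folklore] -/
def T (x : ℂ) : ℝ := dirCoord (hub.km + 1) (x - hub.pmid)

/-- The splice points `A± = m + 2 r_h d±`. [folklore] -/
def A (sgn : ℝ) : ℂ := hub.m + ((2 * hub.rh : ℝ) : ℂ) * hub.dEnd sgn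

/-- The endpoints of the flat piece `q± = pmid ± 8 ℓ τ` (`q₁ = q(-1)`, `q₂ = q(1)`). [folklore] -/
def q (sgn : ℝ) : ℂ := hub.pmid + ((sgn * (8 * hub.ell) : ℝ) : ℂ) * hub.τ

/-- The first exit of the ray in direction `d`. [folklore] -/
def L (d : ℂ) : ℝ := firstExit Ω hub.m d

/-! ### Basic inequalities -/

/-- `0 < r*`, `0 < ρ_B`, `‖e - m‖ = ρ_B`. [folklore] -/
theorem ρB_spec : 0 < hub.ρB ∧ ‖hub.e - hub.m‖ = hub.ρB := by
  refine ⟨by unfold ρB; linarith [hub.rstar_pos], ?_⟩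
  rw [norm_sub_rev, hub.norm_sub]; rfl

/-- `|b| ≤ a`, `ρ_B² ≤ 2 a²`, `0 < a`. [folklore] -/
theorem ab_spec : |hub.b| ≤ hub.a ∧ hub.ρB ^ 2 ≤ 2 * hub.a ^ 2 ∧ 0 < hub.a := by
  have h1 : |hub.b| ≤ hub.a := hub.dir_le
  have h2 : ‖hub.e - hub.m‖ ^ 2 ≤ 2 * hub.a ^ 2 := two_mul_sq_dirCoord_ge hub.dir_le
  rw [hub.ρB_spec.2] at h2
  refine ⟨h1, h2, ?_⟩
  have hρ := hub.ρB_spec.1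
  by_contra h; push Not at h
  have : hub.a = 0 := le_antisymm h ((abs_nonneg _).trans h1)
  rw [this] at h2; nlinarith

/-- `10 r_h ≤ ρ_B / 51` (the hub ball misses the exterior ball): in particular `r_h ≤ ρ_B / 500`. [folklore] -/
theorem rh_le : 10 * hub.rh + hub.rstar ≤ hub.ρB := by
  -- the point of the segment `[m, e]` at distance `10 r_h` from `m` is in `Ω`, hence not in `ball e r*`
  have hρ := hub.ρB_spec
  have hr := hub.rstar_pos
  have hrh := hub.rh_pos
  rcases le_or_gt hub.ρB (10 * hub.rh) with h10 | h10
  · exfalso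
    refine hub.ball_disjoint hub.e (mem_ball_self hr) (hub.closedBall_subset ?_)
    rw [mem_closedBall, dist_eq_norm, hρ.2]; exact h10
  by_contra h; push Not at h
  set x : ℂ := hub.m + ((10 * hub.rh / hub.ρB : ℝ) : ℂ) * (hub.e - hub.m) with hx
  have hρ1 := hρ.1
  have hxm : x ∈ closedBall hub.m (10 * hub.rh) := by
    rw [mem_closedBall, dist_eq_norm, hx, add_sub_cancel_left, norm_mul, Complex.norm_real, Real.norm_eq_abs, hρ.2,
      abs_of_pos (by positivity), div_mul_cancel₀ _ hρ.1.ne']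
  have hxe : x ∈ ball hub.e hub.rstar := by
    rw [mem_ball, dist_eq_norm, hx]
    have : hub.m + ((10 * hub.rh / hub.ρB : ℝ) : ℂ) * (hub.e - hub.m) - hub.e = ((1 - 10 * hub.rh / hub.ρB : ℝ) : ℂ) * (hub.m - hub.e) := by
      push_cast; ring
    rw [this, norm_mul, Complex.norm_real, Real.norm_eq_abs, norm_sub_rev, hρ.2]
    rw [abs_of_pos (by rw [sub_pos, div_lt_one hρ.1]; exact h10)]
    rw [sub_mul, div_mul_cancel₀ _ hρ.1.ne', one_mul]
    linarith
  exact hub.ball_disjoint x hxe (hub.closedBall_subset hxm)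

/-- `r_h ≤ ρ_B / 500` and `0 < ℓ`, `ℓ = r_h/100`. [folklore] -/
theorem scales : hub.rh ≤ hub.ρB / 500 ∧ 0 < hub.ell ∧ 100 * hub.ell = hub.rh ∧ 0 < hub.rh := by
  have h := hub.rh_le
  have : hub.ρB = 51 / 50 * hub.rstar := rfl
  refine ⟨by nlinarith [hub.rstar_pos], by unfold ell; linarith [hub.rh_pos], by unfold ell; ring, hub.rh_pos⟩

/-! ### The directions -/

/-- `rdot E ν = a`, `rdot E τ = b` for `E = e - m`. [folklore] -/
theorem rdot_ν_τ : rdot (hub.e - hub.m) hub.ν = hub.a ∧ rdot (hub.e - hub.m) hub.τ = hub.b :=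
  ⟨rdot_dirVec _ _, rdot_dirVec _ _⟩

/-- `‖ν‖ = 1`, `‖τ‖ = 1`. [folklore] -/
theorem norm_ν_τ : ‖hub.ν‖ = 1 ∧ ‖hub.τ‖ = 1 := by
  have h : ∀ k : Fin 4, ‖dirVec k‖ = 1 := fun k => by
    rw [Complex.norm_def, Complex.normSq_apply, dirVec_re, dirVec_im, Real.sqrt_eq_one]
    rcases cornerUnit_apply_cases k with ⟨e0, e1⟩ | ⟨e0, e1⟩ | ⟨e0, e1⟩ | ⟨e0, e1⟩ <;> simp [e0, e1]
  exact ⟨h _, h _⟩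

/-- Frame coordinates of `d±`: `(15/17, ±8/17)`. [folklore] -/
theorem dirCoord_dEnd (sgn : ℝ) : dirCoord hub.km (hub.dEnd sgn) = 15 / 17 ∧ dirCoord (hub.km + 1) (hub.dEnd sgn) = sgn * (8 / 17) := by
  simp only [dEnd, ν, τ, dirCoord_add, dirCoord_mul_dirVec_self, dirCoord_mul_dirVec_succ, dirCoord_succ_mul_dirVec,
    add_zero, zero_add, and_self]

/-- `‖d±‖ = 1` for `sgn = ±1`. [folklore] -/
theorem norm_dEnd {sgn : ℝ} (hs : sgn = 1 ∨ sgn = -1) : ‖hub.dEnd sgn‖ = 1 := by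
  have hsq : sgn ^ 2 = 1 := by rcases hs with rfl | rfl <;> norm_num
  obtain ⟨h1, h2⟩ := hub.dirCoord_dEnd sgn
  have key : ‖hub.dEnd sgn‖ ^ 2 = 1 := by
    have hsum : dirCoord hub.km (hub.dEnd sgn) ^ 2 + dirCoord (hub.km + 1) (hub.dEnd sgn) ^ 2 = ‖hub.dEnd sgn‖ ^ 2 := by
      obtain ⟨h0, h1'⟩ := cornerUnit_succ_apply hub.km
      have hn : (cornerUnit hub.km 0 : ℝ) ^ 2 + (cornerUnit hub.km 1 : ℝ) ^ 2 = 1 := by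
        rcases cornerUnit_apply_cases hub.km with ⟨e0, e1⟩ | ⟨e0, e1⟩ | ⟨e0, e1⟩ | ⟨e0, e1⟩ <;> simp [e0, e1]
      rw [Complex.sq_norm, Complex.normSq_apply]
      simp only [dirCoord, h0, h1', Int.cast_neg]
      linear_combination ((hub.dEnd sgn).re ^ 2 + (hub.dEnd sgn).im ^ 2) * hn
    rw [← hsum, h1, h2]; nlinarith [hsq]
  have h0 : 0 ≤ ‖hub.dEnd sgn‖ := norm_nonneg _
  nlinarith [key]

/-- `rdot E d± = (15 a ± 8 b)/17 ≥ 7a/17`. [folklore] -/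
theorem rdot_dEnd (sgn : ℝ) (hs : sgn = 1 ∨ sgn = -1) :
    rdot (hub.e - hub.m) (hub.dEnd sgn) = (15 * hub.a + sgn * 8 * hub.b) / 17 ∧ 7 * hub.a / 17 ≤ rdot (hub.e - hub.m) (hub.dEnd sgn) := by
  have h1 : rdot (hub.e - hub.m) (hub.dEnd sgn) = (15 * hub.a + sgn * 8 * hub.b) / 17 := by
    rw [dEnd, rdot_add_right, rdot_real_mul_right, rdot_real_mul_right, hub.rdot_ν_τ.1, hub.rdot_ν_τ.2]; ring
  refine ⟨h1, ?_⟩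
  rw [h1]
  obtain ⟨hab, -, -⟩ := hub.ab_spec
  rw [abs_le] at hab
  rcases hs with rfl | rfl <;> linarith

/-! ### The rays -/

/-- The point `m + s₁ d`, `s₁ = rdot E d ≥ 7a/17`, lies in the exterior ball: the ray leaves `Ω`
before it. [folklore] -/
theorem ray_mid_mem_exterior {d : ℂ} (hd : ‖d‖ = 1) (h7 : 7 * hub.a / 17 ≤ rdot (hub.e - hub.m) d) :
    hub.m + ((rdot (hub.e - hub.m) d : ℝ) : ℂ) * d ∈ ball hub.e hub.rstar := by
  obtain ⟨hρ, hme⟩ := hub.ρB_spec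
  obtain ⟨-, h2a, ha⟩ := hub.ab_spec
  set s₁ := rdot (hub.e - hub.m) d with hs₁def
  have hα : rdot (hub.e - hub.m) d = hub.ρB * (s₁ / hub.ρB) := by rw [← hs₁def]; field_simp
  have key := norm_sq_ray_mid (by rw [norm_sub_rev]; exact hme) hd hα
  rw [show hub.ρB * (s₁ / hub.ρB) = s₁ from by field_simp] at key
  rw [mem_ball, dist_eq_norm]
  -- `ρ_B² (1 - (s₁/ρ_B)²) = ρ_B² - s₁² < r*²` since `s₁² ≥ 49 a²/289 ≥ 49 ρ_B²/578` and `ρ_B = 51 r*/50`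
  have h1 : ‖hub.m + ((s₁ : ℝ) : ℂ) * d - hub.e‖ ^ 2 = hub.ρB ^ 2 - s₁ ^ 2 := by rw [key]; field_simp
  have h2 : 49 * hub.a ^ 2 / 289 ≤ s₁ ^ 2 := by nlinarith
  have h3 : hub.ρB = 51 / 50 * hub.rstar := rfl
  have h4 : hub.ρB ^ 2 - s₁ ^ 2 < hub.rstar ^ 2 := by nlinarith
  have h5 := hub.rstar_pos
  nlinarith [norm_nonneg (hub.m + ((s₁ : ℝ) : ℂ) * d - hub.e)]

/-- **The rays of the fan**: for `d` unit with `rdot E d ≥ 7a/17`, the first exit `L` satisfies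
`10 r_h < L ≤ rdot E d`, the exit point is a boundary point off `Ω`, the ray before it is in
`Ω`, and the ray up to it (excluding `m`) is in the open big ball. [folklore] -/
theorem ray_spec {d : ℂ} (hd : ‖d‖ = 1) (h7 : 7 * hub.a / 17 ≤ rdot (hub.e - hub.m) d) :
    10 * hub.rh < hub.L d ∧ hub.L d ≤ rdot (hub.e - hub.m) d ∧ hub.m + ((hub.L d : ℝ) : ℂ) * d ∉ Ω ∧
      hub.m + ((hub.L d : ℝ) : ℂ) * d ∈ frontier Ω ∧ (∀ s : ℝ, 0 ≤ s → s < hub.L d → hub.m + (s : ℂ) * d ∈ Ω) ∧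
      ∀ s : ℝ, 0 < s → s ≤ hub.L d → hub.m + (s : ℂ) * d ∈ ball hub.e hub.ρB := by
  obtain ⟨hρ, hme⟩ := hub.ρB_spec
  obtain ⟨-, -, ha⟩ := hub.ab_spec
  have hs₁ : 0 ≤ rdot (hub.e - hub.m) d := by linarith
  have hout := hub.ball_disjoint _ (hub.ray_mid_mem_exterior hd h7)
  have hm : hub.m ∈ Ω := hub.closedBall_subset (mem_closedBall_self (by linarith [hub.rh_pos]))
  obtain ⟨hL0, hLle, hLout, hbelow⟩ := firstExit_spec hub.isOpen hm hs₁ hout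
  have hfr := firstExit_mem_frontier hub.isOpen hm hs₁ hout
  refine ⟨?_, hLle, hLout, hfr, hbelow, fun s hs0 hs => ?_⟩
  · -- the exit point is off `Ω ⊇ closedBall m (10 r_h)`
    by_contra h; push Not at h
    apply hLout
    apply hub.closedBall_subset
    rw [mem_closedBall, dist_eq_norm, add_sub_cancel_left, norm_mul, Complex.norm_real, Real.norm_eq_abs, hd, mul_one, abs_of_pos hL0]
    exact h
  · have hα : rdot (hub.e - hub.m) d = hub.ρB * (rdot (hub.e - hub.m) d / hub.ρB) := by field_simp
    refine ray_mem_ball (by rw [norm_sub_rev]; exact hme) hd hα hs0 ?_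
    rw [show 2 * hub.ρB * (rdot (hub.e - hub.m) d / hub.ρB) = 2 * rdot (hub.e - hub.m) d from by field_simp]
    have : 0 < rdot (hub.e - hub.m) d := by linarith
    have hs' : s ≤ firstExit Ω hub.m d := hs
    linarith

/-- The rays of the fan: `ν` and `d±`. [folklore] -/
theorem ray_spec_ν : 10 * hub.rh < hub.L hub.ν ∧ hub.m + ((hub.L hub.ν : ℝ) : ℂ) * hub.ν ∉ Ω ∧
    (∀ s : ℝ, 0 ≤ s → s < hub.L hub.ν → hub.m + (s : ℂ) * hub.ν ∈ Ω) ∧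
    ∀ s : ℝ, 0 < s → s ≤ hub.L hub.ν → hub.m + (s : ℂ) * hub.ν ∈ ball hub.e hub.ρB := by
  have h7 : 7 * hub.a / 17 ≤ rdot (hub.e - hub.m) hub.ν := by rw [hub.rdot_ν_τ.1]; linarith [hub.ab_spec.2.2]
  obtain ⟨h1, -, h3, -, h5, h6⟩ := hub.ray_spec hub.norm_ν_τ.1 h7
  exact ⟨h1, h3, h5, h6⟩

/-- The rays of the fan: `d±`. [folklore] -/
theorem ray_spec_dEnd {sgn : ℝ} (hs : sgn = 1 ∨ sgn = -1) :
    10 * hub.rh < hub.L (hub.dEnd sgn) ∧ hub.m + ((hub.L (hub.dEnd sgn) : ℝ) : ℂ) * hub.dEnd sgn ∉ Ω ∧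
    (∀ s : ℝ, 0 ≤ s → s < hub.L (hub.dEnd sgn) → hub.m + (s : ℂ) * hub.dEnd sgn ∈ Ω) ∧
    ∀ s : ℝ, 0 < s → s ≤ hub.L (hub.dEnd sgn) → hub.m + (s : ℂ) * hub.dEnd sgn ∈ ball hub.e hub.ρB := by
  obtain ⟨h1, -, h3, -, h5, h6⟩ := hub.ray_spec (hub.norm_dEnd hs) (hub.rdot_dEnd sgn hs).2
  exact ⟨h1, h3, h5, h6⟩

/-! ### Frame coordinates of the pieces -/

/-- Frame coordinates of a general point `m + s ν + t τ`-type expression: `N (m + v) = dirCoord km v - r_h`,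
`T (m + v) = dirCoord (km+1) v`. [folklore] -/
theorem NT_add (v : ℂ) : hub.N (hub.m + v) = dirCoord hub.km v - hub.rh ∧ hub.T (hub.m + v) = dirCoord (hub.km + 1) v := by
  have : hub.m + v - hub.pmid = v - ((hub.rh : ℝ) : ℂ) * hub.ν := by rw [pmid]; ring
  simp only [N, T, this, dirCoord_sub, ν, dirCoord_mul_dirVec_self, dirCoord_succ_mul_dirVec, sub_zero, and_self]

/-- Frame coordinates of the ray points `m + s d±`: `N = 15 s/17 - r_h`, `T = ± 8 s/17`. [folklore] -/
theorem NT_ray (sgn s : ℝ) : hub.N (hub.m + (s : ℂ) * hub.dEnd sgn) = 15 * s / 17 - hub.rh ∧ hub.T (hub.m + (s : ℂ) * hub.dEnd sgn) = sgn * (8 * s / 17) := by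
  obtain ⟨h1, h2⟩ := hub.NT_add ((s : ℂ) * hub.dEnd sgn)
  obtain ⟨d1, d2⟩ := hub.dirCoord_dEnd sgn
  rw [h1, h2, dirCoord_real_mul, dirCoord_real_mul, d1, d2]
  constructor <;> ring

/-- Frame coordinates of the axis points `m + s ν`: `N = s - r_h`, `T = 0`. [folklore] -/
theorem NT_axis (s : ℝ) : hub.N (hub.m + (s : ℂ) * hub.ν) = s - hub.rh ∧ hub.T (hub.m + (s : ℂ) * hub.ν) = 0 := by
  obtain ⟨h1, h2⟩ := hub.NT_add ((s : ℂ) * hub.ν)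
  rw [h1, h2]; simp [ν]

/-- Frame coordinates of `A±`: `(13 r_h/17, ±16 r_h/17)`. [folklore] -/
theorem NT_A (sgn : ℝ) : hub.N (hub.A sgn) = 13 * hub.rh / 17 ∧ hub.T (hub.A sgn) = sgn * (16 * hub.rh / 17) := by
  obtain ⟨h1, h2⟩ := hub.NT_ray sgn (2 * hub.rh)
  rw [A, h1, h2]; constructor <;> ring

/-- Frame coordinates of `q±`: `(0, ±8ℓ)`. [folklore] -/
theorem NT_q (sgn : ℝ) : hub.N (hub.q sgn) = 0 ∧ hub.T (hub.q sgn) = sgn * (8 * hub.ell) := by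
  have : hub.q sgn - hub.pmid = ((sgn * (8 * hub.ell) : ℝ) : ℂ) * hub.τ := by rw [q]; ring
  simp only [N, T, this, τ, dirCoord_mul_dirVec_succ, dirCoord_succ_mul_dirVec_succ, and_self]

/-- Frame coordinates of `m`: `(-r_h, 0)`. [folklore] -/
theorem NT_m : hub.N hub.m = -hub.rh ∧ hub.T hub.m = 0 := by
  obtain ⟨h1, h2⟩ := hub.NT_axis 0
  simpa using And.intro h1 h2

/-- Frame coordinates along a segment are affine. [folklore] -/
theorem NT_segment {x y w : ℂ} (hw : w ∈ segment ℝ x y) :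
    ∃ θ : ℝ, 0 ≤ θ ∧ θ ≤ 1 ∧ hub.N w = (1 - θ) * hub.N x + θ * hub.N y ∧ hub.T w = (1 - θ) * hub.T x + θ * hub.T y := by
  rw [segment_eq_image'] at hw
  obtain ⟨θ, ⟨h0, h1⟩, rfl⟩ := hw
  have key : x + θ • (y - x) - hub.pmid = ((1 - θ : ℝ) : ℂ) * (x - hub.pmid) + ((θ : ℝ) : ℂ) * (y - hub.pmid) := by
    rw [Complex.real_smul]; push_cast; ring
  refine ⟨θ, h0, h1, ?_, ?_⟩
  · simp only [N, key, dirCoord_add, dirCoord_real_mul]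
  · simp only [T, key, dirCoord_add, dirCoord_real_mul]

/-- `|N v| , |T v|`-control of distances: `|N x - N y| ≤ ‖x - y‖` and `|T x - T y| ≤ ‖x - y‖`. [folklore] -/
theorem abs_NT_sub_le (x y : ℂ) : |hub.N x - hub.N y| ≤ ‖x - y‖ ∧ |hub.T x - hub.T y| ≤ ‖x - y‖ := by
  have e1 : hub.N x - hub.N y = dirCoord hub.km (x - y) := by rw [N, N, ← dirCoord_sub]; congr 1; ring
  have e2 : hub.T x - hub.T y = dirCoord (hub.km + 1) (x - y) := by rw [T, T, ← dirCoord_sub]; congr 1; ring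
  rw [e1, e2]
  exact KCSignConfig.abs_dirCoord_le_norm hub.km (x - y)

/-- Distances are controlled by the frame: `‖x - y‖ ≤ |N x - N y| + |T x - T y|`. [folklore] -/
theorem norm_sub_le_NT (x y : ℂ) : ‖x - y‖ ≤ |hub.N x - hub.N y| + |hub.T x - hub.T y| := by
  have e1 : hub.N x - hub.N y = dirCoord hub.km (x - y) := by rw [N, N, ← dirCoord_sub]; congr 1; ring
  have e2 : hub.T x - hub.T y = dirCoord (hub.km + 1) (x - y) := by rw [T, T, ← dirCoord_sub]; congr 1; ring
  rw [e1, e2]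
  exact norm_le_abs_dirCoord_add hub.km (x - y)

/-- `a ≥ (7/10) ρ_B`. [folklore] -/
theorem a_ge : 7 / 10 * hub.ρB ≤ hub.a := by
  obtain ⟨-, h2, ha⟩ := hub.ab_spec
  have hρ := hub.ρB_spec.1
  nlinarith

/-! ### The pieces of the middle set -/

/-- The end base points `z₀± = m + (L± - t) d±`. [folklore] -/
def z0 (sgn t : ℝ) : ℂ := hub.m + ((hub.L (hub.dEnd sgn) - t : ℝ) : ℂ) * hub.dEnd sgn

/-- The middle path of end `±`: from `z₀±` along the ray to `A±`, then the splice to `q±`. [folklore] -/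
def Mpath (sgn t : ℝ) : Path (hub.z0 sgn t) (hub.q sgn) := (Path.segment (hub.z0 sgn t) (hub.A sgn)).trans (Path.segment (hub.A sgn) (hub.q sgn))

/-- The range of the middle path is the union of its two segments. [folklore] -/
theorem range_Mpath (sgn t : ℝ) : range (hub.Mpath sgn t) = segment ℝ (hub.z0 sgn t) (hub.A sgn) ∪ segment ℝ (hub.A sgn) (hub.q sgn) := by
  rw [Mpath, Path.trans_range, Path.range_segment, Path.range_segment]

/-- Frame coordinates of `z₀±`. [folklore] -/
theorem NT_z0 (sgn t : ℝ) : hub.N (hub.z0 sgn t) = 15 * (hub.L (hub.dEnd sgn) - t) / 17 - hub.rh ∧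
    hub.T (hub.z0 sgn t) = sgn * (8 * (hub.L (hub.dEnd sgn) - t) / 17) := hub.NT_ray sgn _

/-- **Frame facts of the middle paths**: `N ≥ 0`, `± T ≥ 8ℓ`, and `± T ≥ 8ℓ + N` or `± T ≥ 16 r_h/17`. [folklore] -/
theorem frame_Mpath {sgn t : ℝ} (hs : sgn = 1 ∨ sgn = -1) (ht : t ≤ hub.rh) {x : ℂ} (hx : x ∈ range (hub.Mpath sgn t)) :
    0 ≤ hub.N x ∧ 8 * hub.ell ≤ sgn * hub.T x ∧ (8 * hub.ell + hub.N x ≤ sgn * hub.T x ∨ 16 * hub.rh / 17 ≤ sgn * hub.T x) := by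
  have hsq : sgn * sgn = 1 := by rcases hs with rfl | rfl <;> norm_num
  obtain ⟨hL, -, -, -⟩ := hub.ray_spec_dEnd hs
  obtain ⟨-, hℓ, hℓr, hrh⟩ := hub.scales
  obtain ⟨nz, tz⟩ := hub.NT_z0 sgn t
  obtain ⟨nA, tA⟩ := hub.NT_A sgn
  obtain ⟨nq, tq⟩ := hub.NT_q sgn
  rw [range_Mpath] at hx
  rcases hx with hx | hx
  · obtain ⟨θ, h0, h1, hN, hT⟩ := hub.NT_segment hx
    rw [hN, hT, nz, tz, nA, tA]
    have hT' : sgn * ((1 - θ) * (sgn * (8 * (hub.L (hub.dEnd sgn) - t) / 17)) + θ * (sgn * (16 * hub.rh / 17))) =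
        (1 - θ) * (8 * (hub.L (hub.dEnd sgn) - t) / 17) + θ * (16 * hub.rh / 17) := by
      have : sgn * ((1 - θ) * (sgn * (8 * (hub.L (hub.dEnd sgn) - t) / 17)) + θ * (sgn * (16 * hub.rh / 17))) =
          sgn * sgn * ((1 - θ) * (8 * (hub.L (hub.dEnd sgn) - t) / 17) + θ * (16 * hub.rh / 17)) := by ring
      rw [this, hsq, one_mul]
    rw [hT']
    refine ⟨by nlinarith, by nlinarith, Or.inr (by nlinarith)⟩
  · obtain ⟨θ, h0, h1, hN, hT⟩ := hub.NT_segment hx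
    rw [hN, hT, nA, tA, nq, tq]
    have hT' : sgn * ((1 - θ) * (sgn * (16 * hub.rh / 17)) + θ * (sgn * (8 * hub.ell))) = (1 - θ) * (16 * hub.rh / 17) + θ * (8 * hub.ell) := by
      have : sgn * ((1 - θ) * (sgn * (16 * hub.rh / 17)) + θ * (sgn * (8 * hub.ell))) =
          sgn * sgn * ((1 - θ) * (16 * hub.rh / 17) + θ * (8 * hub.ell)) := by ring
      rw [this, hsq, one_mul]
    rw [hT']
    refine ⟨by nlinarith, by nlinarith, Or.inl (by nlinarith)⟩

/-- **Frame facts of the flat piece**: `N = 0`, `|T| ≤ 8ℓ`. [folklore] -/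
theorem frame_F {x : ℂ} (hx : x ∈ segment ℝ (hub.q (-1)) (hub.q 1)) : hub.N x = 0 ∧ |hub.T x| ≤ 8 * hub.ell := by
  obtain ⟨θ, h0, h1, hN, hT⟩ := hub.NT_segment hx
  obtain ⟨n1, t1⟩ := hub.NT_q (-1)
  obtain ⟨n2, t2⟩ := hub.NT_q 1
  have hℓ := hub.scales.2.1
  rw [hN, hT, n1, n2, t1, t2]
  refine ⟨by ring, ?_⟩
  rw [abs_le]; constructor <;> nlinarith

/-- The middle set of the hub at end depth `t`. [folklore] -/
def MsetH (t : ℝ) : Set ℂ := range (hub.Mpath (-1) t) ∪ segment ℝ (hub.q (-1)) (hub.q 1) ∪ range (hub.Mpath 1 t)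

/-- **Consequences for the middle set**: `N ≥ 0`; `|T| < 8ℓ ⇒ N = 0`; `N ≥ 3 r_h/4 ⇒ |T| ≥ 3 r_h/4`. [folklore] -/
theorem frame_MsetH {t : ℝ} (ht : t ≤ hub.rh) {x : ℂ} (hx : x ∈ hub.MsetH t) :
    0 ≤ hub.N x ∧ (|hub.T x| < 8 * hub.ell → hub.N x = 0) ∧ (3 * hub.rh / 4 ≤ hub.N x → 3 * hub.rh / 4 ≤ |hub.T x|) := by
  obtain ⟨-, hℓ, hℓr, hrh⟩ := hub.scales
  rcases hx with (hx | hx) | hx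
  · obtain ⟨h1, h2, h3⟩ := hub.frame_Mpath (Or.inr rfl) ht hx
    have hT : |hub.T x| = -hub.T x := by
      rw [abs_of_nonpos]; linarith
    refine ⟨h1, fun h => ?_, fun h => ?_⟩
    · rw [hT] at h; linarith
    · rw [hT]; rcases h3 with h3 | h3 <;> linarith
  · obtain ⟨h1, h2⟩ := hub.frame_F hx
    refine ⟨h1.ge, fun _ => h1, fun h => ?_⟩
    linarith
  · obtain ⟨h1, h2, h3⟩ := hub.frame_Mpath (Or.inl rfl) ht hx
    have hT : |hub.T x| = hub.T x := by
      rw [abs_of_nonneg]; linarith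
    refine ⟨h1, fun h => ?_, fun h => ?_⟩
    · rw [hT] at h; linarith
    · rw [hT]; rcases h3 with h3 | h3 <;> linarith

/-- Points of the middle paths have `|T| ≥ 8ℓ`. [folklore] -/
theorem abs_T_ge_of_mem_Mpath {sgn t : ℝ} (hs : sgn = 1 ∨ sgn = -1) (ht : t ≤ hub.rh) {x : ℂ} (hx : x ∈ range (hub.Mpath sgn t)) :
    8 * hub.ell ≤ |hub.T x| := by
  obtain ⟨-, h2, -⟩ := hub.frame_Mpath hs ht hx
  rcases hs with rfl | rfl
  · rw [one_mul] at h2; exact h2.trans (le_abs_self _)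
  · rw [neg_one_mul] at h2; exact h2.trans (neg_le_abs _)

/-! ### The pieces lie in the big ball and in `Ω` -/

/-- Ray points as convex combinations: the segment between two ray points consists of ray points. [folklore] -/
theorem segment_ray_subset (d : ℂ) {s₁ s₂ : ℝ} (h : s₁ ≤ s₂) :
    segment ℝ (hub.m + (s₁ : ℂ) * d) (hub.m + (s₂ : ℂ) * d) ⊆ {x | ∃ s, s₁ ≤ s ∧ s ≤ s₂ ∧ x = hub.m + (s : ℂ) * d} := by
  intro x hx
  rw [segment_eq_image'] at hx
  obtain ⟨θ, ⟨h0, h1⟩, rfl⟩ := hx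
  refine ⟨s₁ + θ * (s₂ - s₁), by nlinarith, by nlinarith, ?_⟩
  show hub.m + (s₁ : ℂ) * d + θ • (hub.m + (s₂ : ℂ) * d - (hub.m + (s₁ : ℂ) * d)) = _
  rw [Complex.real_smul]; push_cast; ring

/-- `q±` lies in the big ball. [folklore] -/
theorem q_mem_ball {sgn : ℝ} (hs : sgn = 1 ∨ sgn = -1) : hub.q sgn ∈ ball hub.e hub.ρB := by
  obtain ⟨hρ, hme⟩ := hub.ρB_spec
  obtain ⟨hab, -, ha⟩ := hub.ab_spec
  obtain ⟨hrρ, hℓ, hℓr, hrh⟩ := hub.scales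
  have ha7 := hub.a_ge
  have hsq : sgn ^ 2 = 1 := by rcases hs with rfl | rfl <;> norm_num
  have hq : hub.q sgn = hub.m + (((hub.rh : ℝ) : ℂ) * hub.ν + ((sgn * (8 * hub.ell) : ℝ) : ℂ) * hub.τ) := by
    rw [q, pmid]; ring
  rw [hq, add_mem_ball_iff (by rw [norm_sub_rev]; exact hme)]
  rw [rdot_add_right, rdot_real_mul_right, rdot_real_mul_right, hub.rdot_ν_τ.1, hub.rdot_ν_τ.2]
  have hnorm : ‖((hub.rh : ℝ) : ℂ) * hub.ν + ((sgn * (8 * hub.ell) : ℝ) : ℂ) * hub.τ‖ ^ 2 = hub.rh ^ 2 + (8 * hub.ell) ^ 2 := by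
    obtain ⟨h1, h2⟩ : dirCoord hub.km (((hub.rh : ℝ) : ℂ) * hub.ν + ((sgn * (8 * hub.ell) : ℝ) : ℂ) * hub.τ) = hub.rh ∧
        dirCoord (hub.km + 1) (((hub.rh : ℝ) : ℂ) * hub.ν + ((sgn * (8 * hub.ell) : ℝ) : ℂ) * hub.τ) = sgn * (8 * hub.ell) :=
      dirCoord_frame_comb hub.km hub.rh (sgn * (8 * hub.ell))
    have key := KCSignConfig.abs_dirCoord_le_norm hub.km (((hub.rh : ℝ) : ℂ) * hub.ν + ((sgn * (8 * hub.ell) : ℝ) : ℂ) * hub.τ)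
    have key2 := norm_le_abs_dirCoord_add hub.km (((hub.rh : ℝ) : ℂ) * hub.ν + ((sgn * (8 * hub.ell) : ℝ) : ℂ) * hub.τ)
    -- exact computation via the frame identity `‖w‖² = N² + T²`
    have hsum : ∀ w : ℂ, dirCoord hub.km w ^ 2 + dirCoord (hub.km + 1) w ^ 2 = ‖w‖ ^ 2 := fun w => by
      obtain ⟨h0, h1'⟩ := cornerUnit_succ_apply hub.km
      have hn : (cornerUnit hub.km 0 : ℝ) ^ 2 + (cornerUnit hub.km 1 : ℝ) ^ 2 = 1 := by
        rcases cornerUnit_apply_cases hub.km with ⟨e0, e1⟩ | ⟨e0, e1⟩ | ⟨e0, e1⟩ | ⟨e0, e1⟩ <;> simp [e0, e1]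
      rw [Complex.sq_norm, Complex.normSq_apply]
      simp only [dirCoord, h0, h1', Int.cast_neg]
      linear_combination (w.re ^ 2 + w.im ^ 2) * hn
    rw [← hsum, h1, h2]; nlinarith [hsq]
  rw [hnorm, abs_le] at *
  rcases hs with rfl | rfl <;> nlinarith [hab.1, hab.2]

/-- `A±` and `z₀±` lie in the big ball, for `0 ≤ t < L - …`. [folklore] -/
theorem A_z0_mem_ball {sgn t : ℝ} (hs : sgn = 1 ∨ sgn = -1) (ht0 : 0 ≤ t) (ht : t ≤ hub.rh) :
    hub.A sgn ∈ ball hub.e hub.ρB ∧ hub.z0 sgn t ∈ ball hub.e hub.ρB := by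
  obtain ⟨hL, -, -, hball⟩ := hub.ray_spec_dEnd hs
  have hrh := hub.rh_pos
  exact ⟨hball _ (by linarith) (by linarith), hball _ (by linarith) (by linarith)⟩

/-- **The middle set lies in the big ball.** [folklore] -/
theorem MsetH_subset_ball {t : ℝ} (ht0 : 0 ≤ t) (ht : t ≤ hub.rh) : hub.MsetH t ⊆ ball hub.e hub.ρB := by
  have hc : Convex ℝ (ball hub.e hub.ρB) := convex_ball _ _
  rintro x ((hx | hx) | hx)
  · rw [range_Mpath] at hx
    obtain ⟨hA, hz⟩ := hub.A_z0_mem_ball (Or.inr rfl) ht0 ht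
    rcases hx with hx | hx
    · exact hc.segment_subset hz hA hx
    · exact hc.segment_subset hA (hub.q_mem_ball (Or.inr rfl)) hx
  · exact hc.segment_subset (hub.q_mem_ball (Or.inr rfl)) (hub.q_mem_ball (Or.inl rfl)) hx
  · rw [range_Mpath] at hx
    obtain ⟨hA, hz⟩ := hub.A_z0_mem_ball (Or.inl rfl) ht0 ht
    rcases hx with hx | hx
    · exact hc.segment_subset hz hA hx
    · exact hc.segment_subset hA (hub.q_mem_ball (Or.inl rfl)) hx

/-- `A±` and `q±` lie in the hub ball `closedBall m (2 r_h)`. [folklore] -/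
theorem A_q_mem_closedBall {sgn : ℝ} (hs : sgn = 1 ∨ sgn = -1) :
    hub.A sgn ∈ closedBall hub.m (2 * hub.rh) ∧ hub.q sgn ∈ closedBall hub.m (2 * hub.rh) := by
  obtain ⟨hrρ, hℓ, hℓr, hrh⟩ := hub.scales
  constructor
  · rw [mem_closedBall, dist_eq_norm, A, add_sub_cancel_left, norm_mul, Complex.norm_real, Real.norm_eq_abs, hub.norm_dEnd hs, mul_one,
      abs_of_pos (by linarith)]
  · rw [mem_closedBall, dist_eq_norm]
    have hq : hub.q sgn - hub.m = ((hub.rh : ℝ) : ℂ) * hub.ν + ((sgn * (8 * hub.ell) : ℝ) : ℂ) * hub.τ := by rw [q, pmid]; ring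
    rw [hq]
    refine (norm_le_abs_dirCoord_add hub.km _).trans ?_
    obtain ⟨h1, h2⟩ : dirCoord hub.km (((hub.rh : ℝ) : ℂ) * hub.ν + ((sgn * (8 * hub.ell) : ℝ) : ℂ) * hub.τ) = hub.rh ∧
        dirCoord (hub.km + 1) (((hub.rh : ℝ) : ℂ) * hub.ν + ((sgn * (8 * hub.ell) : ℝ) : ℂ) * hub.τ) = sgn * (8 * hub.ell) :=
      dirCoord_frame_comb hub.km hub.rh (sgn * (8 * hub.ell))
    rw [h1, h2, abs_of_pos hrh, abs_mul]
    have : |sgn| = 1 := by rcases hs with rfl | rfl <;> norm_num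
    rw [this, one_mul, abs_of_pos (by linarith)]
    linarith

/-- **The middle set lies in `Ω`**, for `0 < t ≤ r_h`. [folklore] -/
theorem MsetH_subset {t : ℝ} (ht0 : 0 < t) (ht : t ≤ hub.rh) : hub.MsetH t ⊆ Ω := by
  have hc : Convex ℝ (closedBall hub.m (10 * hub.rh)) := convex_closedBall _ _
  have hsub : closedBall hub.m (2 * hub.rh) ⊆ closedBall hub.m (10 * hub.rh) := closedBall_subset_closedBall (by linarith [hub.rh_pos])
  have hrays : ∀ sgn : ℝ, (sgn = 1 ∨ sgn = -1) → segment ℝ (hub.z0 sgn t) (hub.A sgn) ⊆ Ω := by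
    intro sgn hs x hx
    obtain ⟨hL, -, hbelow, -⟩ := hub.ray_spec_dEnd hs
    rw [segment_symm] at hx
    have hx' : x ∈ segment ℝ (hub.m + ((2 * hub.rh : ℝ) : ℂ) * hub.dEnd sgn) (hub.m + ((hub.L (hub.dEnd sgn) - t : ℝ) : ℂ) * hub.dEnd sgn) := hx
    obtain ⟨s, hs1, hs2, hxs⟩ := hub.segment_ray_subset (hub.dEnd sgn) (by linarith) hx'
    rw [hxs]
    exact hbelow s (by linarith [hub.rh_pos]) (by linarith)
  rintro x ((hx | hx) | hx)
  · rw [range_Mpath] at hx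
    rcases hx with hx | hx
    · exact hrays (-1) (Or.inr rfl) hx
    · obtain ⟨hA, hq⟩ := hub.A_q_mem_closedBall (Or.inr rfl)
      exact hub.closedBall_subset (hc.segment_subset (hsub hA) (hsub hq) hx)
  · obtain ⟨-, hq1⟩ := hub.A_q_mem_closedBall (Or.inr rfl)
    obtain ⟨-, hq2⟩ := hub.A_q_mem_closedBall (Or.inl rfl)
    exact hub.closedBall_subset (hc.segment_subset (hsub hq1) (hsub hq2) hx)
  · rw [range_Mpath] at hx
    rcases hx with hx | hx
    · exact hrays 1 (Or.inl rfl) hx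
    · obtain ⟨hA, hq⟩ := hub.A_q_mem_closedBall (Or.inl rfl)
      exact hub.closedBall_subset (hc.segment_subset (hsub hA) (hsub hq) hx)

/-- The middle set is compact. [folklore] -/
theorem isCompact_MsetH (t : ℝ) : IsCompact (hub.MsetH t) := by
  refine ((isCompact_range (hub.Mpath (-1) t).continuous).union ?_).union (isCompact_range (hub.Mpath 1 t).continuous)
  rw [← Path.range_segment]; exact isCompact_range (Path.segment _ _).continuous

/-! ### The end zones -/

/-- **Frame fact of the end zones**: points within `ℓ¹`-distance `r_h/10` of `z₀±` have `± T ≥ 4 r_h`. [folklore] -/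
theorem frame_zone {sgn t : ℝ} (hs : sgn = 1 ∨ sgn = -1) (ht : t ≤ hub.rh) {w : ℂ} (hw : l1norm (w - hub.z0 sgn t) ≤ hub.rh / 10) :
    4 * hub.rh ≤ sgn * hub.T w := by
  obtain ⟨hL, -, -, -⟩ := hub.ray_spec_dEnd hs
  have hrh := hub.rh_pos
  obtain ⟨-, tz⟩ := hub.NT_z0 sgn t
  have hd : |hub.T w - hub.T (hub.z0 sgn t)| ≤ hub.rh / 10 := ((hub.abs_NT_sub_le w _).2.trans (norm_le_l1norm _)).trans hw
  rw [tz, abs_le] at hd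
  have hsq : sgn * sgn = 1 := by rcases hs with rfl | rfl <;> norm_num
  have : sgn * hub.T w = sgn * (hub.T w - sgn * (8 * (hub.L (hub.dEnd sgn) - t) / 17)) + 8 * (hub.L (hub.dEnd sgn) - t) / 17 := by
    have : sgn * (sgn * (8 * (hub.L (hub.dEnd sgn) - t) / 17)) = sgn * sgn * (8 * (hub.L (hub.dEnd sgn) - t) / 17) := by ring
    rw [mul_sub, this, hsq, one_mul]; ring
  rw [this]
  rcases hs with rfl | rfl <;> nlinarith [hd.1, hd.2]

/-- **The end zones lie in the big ball**: points within distance `r_h` of `z₀±`. [folklore] -/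
theorem zone_subset_ball {sgn t : ℝ} (hs : sgn = 1 ∨ sgn = -1) (ht0 : 0 ≤ t) (ht : t ≤ hub.rh) {w : ℂ} (hw : ‖w - hub.z0 sgn t‖ ≤ hub.rh) :
    w ∈ ball hub.e hub.ρB := by
  obtain ⟨hρ, hme⟩ := hub.ρB_spec
  obtain ⟨hL, -, -, -⟩ := hub.ray_spec_dEnd hs
  obtain ⟨-, hLle, -, -, -, -⟩ := hub.ray_spec (hub.norm_dEnd hs) (hub.rdot_dEnd sgn hs).2
  have h7 := (hub.rdot_dEnd sgn hs).2
  have ha7 := hub.a_ge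
  have hrh := hub.rh_pos
  set s : ℝ := hub.L (hub.dEnd sgn) - t with hsdef
  set s₁ : ℝ := rdot (hub.e - hub.m) (hub.dEnd sgn)
  have hs9 : 9 * hub.rh ≤ s := by rw [hsdef]; linarith
  have hsle : s ≤ s₁ := by rw [hsdef]; linarith
  -- `‖z₀ - e‖² = ρ_B² - 2 s s₁ + s² ≤ ρ_B² - s s₁ ≤ ρ_B² - 9 r_h (7a/17)`
  have key := norm_sq_ray_sub hub.m hub.e (hub.dEnd sgn) (hub.norm_dEnd hs) s
  rw [show ‖hub.m - hub.e‖ = hub.ρB from by rw [norm_sub_rev]; exact hme] at key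
  have hz : ‖hub.z0 sgn t - hub.e‖ ^ 2 ≤ hub.ρB ^ 2 - 9 * hub.rh * (7 * hub.a / 17) := by
    rw [z0, ← hsdef, key]
    nlinarith
  have hz2 : ‖hub.z0 sgn t - hub.e‖ ^ 2 < (hub.ρB - hub.rh) ^ 2 := by nlinarith
  have hρr : 0 ≤ hub.ρB - hub.rh := by linarith [hub.scales.1]
  have hz3 : ‖hub.z0 sgn t - hub.e‖ < hub.ρB - hub.rh := by
    by_contra h; push Not at h
    have := mul_self_le_mul_self hρr h
    nlinarith
  rw [mem_ball, dist_eq_norm]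
  calc ‖w - hub.e‖ = ‖(w - hub.z0 sgn t) + (hub.z0 sgn t - hub.e)‖ := by congr 1; ring
    _ ≤ ‖w - hub.z0 sgn t‖ + ‖hub.z0 sgn t - hub.e‖ := norm_add_le _ _
    _ < hub.rh + (hub.ρB - hub.rh) := add_lt_add_of_le_of_lt hw hz3
    _ = hub.ρB := by ring

/-! ### The axis -/

/-- The axis points `m + s ν`. [folklore] -/
def ax (s : ℝ) : ℂ := hub.m + (s : ℂ) * hub.ν

/-- `pmid`, `yPlus`, `yMinus` are axis points. [folklore] -/
theorem ax_eq : hub.pmid = hub.ax hub.rh ∧ hub.pmid + ((hub.ell : ℝ) : ℂ) * hub.ν = hub.ax (hub.rh + hub.ell) ∧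
    hub.pmid - ((hub.ell : ℝ) : ℂ) * hub.ν = hub.ax (hub.rh - hub.ell) ∧ hub.m = hub.ax 0 := by
  refine ⟨rfl, ?_, ?_, ?_⟩ <;> simp only [ax, pmid] <;> push_cast <;> ring

/-- **Axis points are off the middle set**: those with `s < r_h` (negative `N`) and those with
`r_h < s` (positive `N`, `T = 0`). [folklore] -/
theorem ax_not_mem_MsetH {t : ℝ} (ht : t ≤ hub.rh) {s : ℝ} (hs : s < hub.rh ∨ hub.rh < s) : hub.ax s ∉ hub.MsetH t := by
  intro hmem
  obtain ⟨h1, h2, -⟩ := hub.frame_MsetH ht hmem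
  obtain ⟨hn, htc⟩ := hub.NT_axis s
  rw [ax] at h1 h2
  rw [hn] at h1 h2; rw [htc] at h2
  have hℓ := hub.scales.2.1
  rcases hs with hs | hs
  · linarith
  · have := h2 (by rw [abs_zero]; linarith); linarith

end HubData

end Literature.Probability.LatticeModels
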